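import Summits.BirchSwinnertonDyer.BirchSwinnertonDyer.Theorems.CumulativeHeegnerLeopoldtRedSplitControlAtThreeShaDualAnnihilator
import Summits.BirchSwinnertonDyer.BirchSwinnertonDyer.Theorems.SchneiderFreeAdditiveX3PoitouTateUnramifiedOrthogonalAllLevels
import HarnessLib

/-!
# Poitou–Tate, the annihilator of `Ш¹` — for THE invariant maps (`LocalInvariants.canonical K n`), at ONE
# level `n`, from the middle exactness `Ker γ¹ ⊆ Im β¹` at that level (Milne I Thm. 4.10 (b) ⟹ half of (a))

Cell `bsd-wall`, seat `bsd-line-chl-p2` g5 (crux K4 stmt-BirchSwinnertonDyer-24200, stub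
`stub_poitouTateShaTateDual`).  The three files `…ShaDualFiniteDuality`, `…ShaDualNewPlace`,
`…ShaDualAnnihilator` prove `Ш¹(K, M^D)^⊥ ⊆ γ¹(P¹(K, M))` for ANY family of local invariant maps with
`IsPerfect`, `UnramifiedOrthogonal`, `SelmerComplement`.  Route A of cell `bsd-schneider` works with THE family
`LocalInvariants.canonical K n` (local residue maps + archimedean invariants), for which the tree already PROVES
`IsPerfect` (`LocalInvariants.canonical_isPerfect`) and Milne I Thm. 2.6 at every level
(`PoitouTateReduction.unramifiedOrthogonal_of_isPerfect_allLevels`), and REDUCES `SelmerComplement` at level `n` to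
the single printed statement `hE(n)` = Milne I 4.10 (b) `Ker γ¹ ⊆ Im β¹` for the canonical family at level `n`
(`PoitouTateReduction.selmerComplement_canonical_of_middleExact_allLevels`).  Hence, for a totally complex `K`:

* `sha_annihilator_canonical_of_middleExact` — **`hE(n)` alone ⟹ every additive `φ : H¹(K, M^D) → ℤ/n`
  vanishing on `Ш¹(K, M^D)` is `y ↦ ∑_v inv_v(t_v ∪ y_v)` for ONE `t ∈ P¹(K, M)`**, for every finite
  `n`-torsion `M` — the exact plug for the last step of Route A's `Ш²(K, M) ≅ coker γ¹ ≅ Ш¹(K, M^D)^*`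
  (item 20462 `poitouTate_sha_tateDual`, consumed by K4 24200, UTD 20386, SOED, 19295's `stub_coinv`), at the
  SAME level `n` and for the SAME family as `hE(n)`; no quantification over all levels is needed.

Theorems only; CONDITIONAL on `hE(n)` (displayed hypothesis, Route A's deliverable); closes no item; BSD is not
proved by any of this.  `K : Type` (universe `0`), as in the `PoitouTateReduction` files.

References: [MilneADT2006] I Cor. 2.3, Thm. 2.6, Thm. 4.10 (a)(b); [Howard2004HeegnerKolyvagin] Thm. 2.1.11.
-/

noncomputable section

open Function NumberField IsDedekindDomain
open scoped NumberField

set_option linter.dupNamespace false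
set_option autoImplicit false

namespace Summit.BirchSwinnertonDyer.BirchSwinnertonDyer.Theorems.PoitouTateShaAnnihilator

open Literature.NumberTheory.GaloisRepresentations
open Literature.NumberTheory.GaloisRepresentations.DiscreteGaloisModule (mu localTatePairingZMod tateDual
  unramifiedSubgroup SelmerStructure)
open Literature.NumberTheory.GaloisCohomology
open Summit.BirchSwinnertonDyer.BirchSwinnertonDyer.Theorems.SchneiderFreeAdditiveX3.PoitouTateReduction

variable {K : Type} [Field K] [NumberField K]

/-- **The annihilator of `Ш¹(K, M^D)` for THE invariant maps, from `Ker γ¹ ⊆ Im β¹` at level `n`.**  Let `K` be a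
totally complex number field and `n ≥ 1`; assume Milne I Thm. 4.10 (b) for the canonical family at level `n`
(hypothesis `hE`: for every finite `n`-torsion `M`, every admissible `S` and every family `t_v ∈ H¹(K_v, M)`,
`v ∈ S`, orthogonal to `H¹_S(K, M^D)` under `∑_{v ∈ S} inv_v(· ∪ ·)`, there is `x ∈ H¹_S(K, M)` with
`loc_v x = t_v` on `S`).  Then for every finite discrete `n`-torsion `M` unramified off the finite `S₀ ⊇ {v ∣ ∞}
∪ {v ∣ n}` and every additive `φ : H¹(K, M^D) → ℤ/n` vanishing on `Ш¹(K, M^D)` there are a finite `S₁ ⊇ S₀` and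
a family `t_v ∈ H¹(K_v, M)`, zero at the infinite places and unramified off `S₁`, with
`φ(y) = ∑_{v ∈ S} inv_v(t_v ∪ loc_v y)` (canonical `inv_v`) for all `y` and all finite `S ⊇ S₁` off which `y` is
unramified.  (`canonical_isPerfect`, `unramifiedOrthogonal_of_isPerfect_allLevels`,
`selmerComplement_canonical_of_middleExact_allLevels`, `exists_family_sum_localTatePairing_eq_of_isTotallyComplex`.)
[cite: MilneADT2006, Ch. I, Thm. 4.10 (a)(b), Cor. 2.3, Thm. 2.6]
[cite: Howard2004HeegnerKolyvagin, Thm. 2.1.11 (arXiv:1202.6340 p. 6)] -/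
theorem sha_annihilator_canonical_of_middleExact [IsTotallyComplex K] (n : ℕ) [NeZero n]
    (hE : ∀ ⦃M : Type⦄ [AddCommGroup M] [TopologicalSpace M] [DiscreteTopology M] [Finite M]
      (ρ : DiscreteGaloisModule K M), (∀ m : M, n • m = 0) →
      ∀ S : Finset (Place K), (∀ w : InfinitePlace K, (Sum.inl w : Place K) ∈ S) →
        (∀ v : HeightOneSpectrum (𝓞 K), (Sum.inr v : Place K) ∉ S →
          ((n : ℕ) : 𝓞 K) ∉ v.asIdeal ∧ GaloisRep.IsUnramifiedAt v ρ) →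
        ∀ t : Π v : Place K, galoisCohomology (ρ.toLocal v) 1,
          (∀ y : galoisCohomology (ρ.tateDual n) 1,
            (∀ v : HeightOneSpectrum (𝓞 K), (Sum.inr v : Place K) ∉ S →
              galoisCohomology.localization (ρ.tateDual n) (Sum.inr v) 1 y ∈
                unramifiedSubgroup (GaloisRep.toLocal v (ρ.tateDual n)) 1) →
            ∑ v ∈ S, localTatePairingZMod ρ n v (LocalInvariants.canonical K n v) (t v)
              (galoisCohomology.localization (ρ.tateDual n) v 1 y) = 0) →
          ∃ x : galoisCohomology ρ 1,
            (∀ v : HeightOneSpectrum (𝓞 K), (Sum.inr v : Place K) ∉ S →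
              galoisCohomology.localization ρ (Sum.inr v) 1 x ∈
                unramifiedSubgroup (GaloisRep.toLocal v ρ) 1) ∧
            ∀ v ∈ S, galoisCohomology.localization ρ v 1 x = t v)
    {M : Type} [AddCommGroup M] [TopologicalSpace M] [DiscreteTopology M] [Finite M]
    (ρ : DiscreteGaloisModule K M) (hM : ∀ m : M, n • m = 0)
    (S₀ : Finset (Place K)) (hinf : ∀ w : InfinitePlace K, (Sum.inl w : Place K) ∈ S₀)
    (hS₀ : ∀ v : HeightOneSpectrum (𝓞 K), (Sum.inr v : Place K) ∉ S₀ →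
      ((n : ℕ) : 𝓞 K) ∉ v.asIdeal ∧ GaloisRep.IsUnramifiedAt v ρ)
    (φ : galoisCohomology (ρ.tateDual n) 1 →+ ZMod n)
    (hφ : ∀ y ∈ DiscreteGaloisModule.sha (ρ.tateDual n), φ y = 0) :
    ∃ (S₁ : Finset (Place K)) (t : Π v : Place K, galoisCohomology (ρ.toLocal v) 1),
      S₀ ⊆ S₁ ∧ (∀ w : InfinitePlace K, t (Sum.inl w) = 0) ∧
      (∀ v : HeightOneSpectrum (𝓞 K), (Sum.inr v : Place K) ∉ S₁ →
        t (Sum.inr v) ∈ unramifiedSubgroup (GaloisRep.toLocal v ρ) 1) ∧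
      ∀ (y : galoisCohomology (ρ.tateDual n) 1) (S : Finset (Place K)), S₁ ⊆ S →
        (∀ v : HeightOneSpectrum (𝓞 K), (Sum.inr v : Place K) ∉ S →
          galoisCohomology.localization (ρ.tateDual n) (Sum.inr v) 1 y ∈
            unramifiedSubgroup (GaloisRep.toLocal v (ρ.tateDual n)) 1) →
        φ y = ∑ v ∈ S, localTatePairingZMod ρ n v (LocalInvariants.canonical K n v) (t v)
          (galoisCohomology.localization (ρ.tateDual n) v 1 y) :=
  exists_family_sum_localTatePairing_eq_of_isTotallyComplex LocalInvariants.canonical_isPerfect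
    (unramifiedOrthogonal_of_isPerfect_allLevels _ LocalInvariants.canonical_isPerfect)
    (selmerComplement_canonical_of_middleExact_allLevels n hE) ρ hM S₀ hinf hS₀ φ hφ

end Summit.BirchSwinnertonDyer.BirchSwinnertonDyer.Theorems.PoitouTateShaAnnihilator

end
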